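import Summits.QuantumFields.YangMills.Theorems.BalabanUVNodesN15KingModelCombesThomasPropagator
import Summits.QuantumFields.YangMills.Theorems.BalabanUVNodesN15KingModelCovariantBlockSmallField
import HarnessLib

/-!
# BalabanUVNodes ∕ N15 — THE KING-MODEL RUNG (PART Ϧ-g): THE HOPPING DIFFERENCE `Δ_U − Δ_V` IS FORM-BOUNDED BY THE COVARIANT DIRICHLET FORM — the bond-pair identity `DU^* + UD^* = DD^*`
# (`D = U − V`), whence `|⟨w,((−cΔ_U+m²) − (−cΔ_V+m²))v⟩| ≤ c(d+1)ε²‖w‖‖v‖ + cε√(d+1)·(‖w‖·E_U(v)^{1∕2} + E_U(w)^{1∕2}·‖v‖)`: the first-order part pairs `U − V` with a covariant GRADIENT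
# — the `H¹` currency in which the Lipschitz constant of `U ↦ G(U)` is `η`-uniform on Bałaban's scale `|U − V| ≤ ε₁η` (PART Ϧ-h assembles it)
# (Track A, DAG node N15 = NE2; FAN-OUT v1.1 §N15 s3 «KING-MODEL RUNG … + what the curved case adds»; count-neutral)

EDITION v1.1 (DOC-ONLY, ERRATUM-Ϧ1, 2026-08-31): locators corrected after ref-J READ-769∕770 — [Balaban1985BackgroundPropagators] (3.37) is on p.396 (not p.397) and (3.48)–(3.50) span pp.398–400 (not p.398),
verified first-hand on the held text (journal page = 388 + file page).  Declarations byte-identical to v1.0.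

HONEST FRAMING.  Count-neutral (cell `pub-ymgap`, seat `pub-ymgap-dag-n15-e` g50; `--supports stmt-QuantumFields-27247 --as helper` = K3ᴬ, KEY MAP v3).  King's one-level comparison model, unitary
link fields, any fibre; OPERATOR-NORM (unweighted) conclusion.  This repairs the honest limitation recorded in PART Ϧ-f: the Lipschitz constant of `U ↦ G(U)` is uniform in the spacing when
the distance of the fields is measured on Bałaban's scale `‖U_b − V_b‖ ≤ ε₁∕L` ([Balaban1985BackgroundPropagators] (3.37): `|U − 1| ≤ εη`-type conditions), because the first-order part of
`Δ_U − Δ_V` is relatively form-bounded by the covariant Dirichlet form.  NOT the weighted (decaying) version of this estimate (Ϧ-f has decay with the cruder constant); NOT analyticity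
([Balaban1985BackgroundPropagators] Thm 3.4; PART Ϛ for the fine covariance); NOT a node discharge (N15 of record untouched); nothing continuum ∕ ℝ⁴ ∕ OS ∕ Clay.

THE RESULTS (`K` any torus in §1–§2; `E_U(v) := Σ_xΣ_μ‖v_x − U(x,μ)v_{x+e_μ}‖²` = Ϳ-b `bondE` summed; `N(v) = ‖v‖²`):
* §1 one bond: `star_dotProduct_mulVec_eq_inner'`, `norm_star_dotProduct_le_fibre`, ★★ **`bond_pair_identity`** — for unitary `U, V`, `D = U − V` and fibre vectors `p, p′, q, q′`:
  `⟨p, Dq′⟩ + ⟨p′, Dᴴq⟩ = ⟨p, DDᴴq⟩ − ⟨p, DUᴴ(q − Uq′)⟩ − ⟨p − Up′, UDᴴq⟩` (the key cancellation `DUᴴ + UDᴴ = DDᴴ`), ★ `norm_bond_pair_le` (`≤ ε²‖p‖‖q‖ + ε‖p‖‖q − Uq′‖ + ε‖p − Up′‖‖q‖`).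
* §2 ★★★ **`norm_form_covLapF_sub_le`** — `|⟨w,((−cΔ_U+m²) − (−cΔ_V+m²))v⟩| ≤ c(d+1)ε²‖w‖‖v‖ + cε√(d+1)·(‖w‖·E_U(v)^{1∕2} + E_U(w)^{1∕2}·‖v‖)` (`c ≥ 0`, `‖U_b − V_b‖ ≤ ε`); `sum_mul_le_sqrt_mul_sqrt_univ`
  (Cauchy–Schwarz), `sqrt_sum_sq_add_le_univ` (Minkowski), ★ `sqrt_dirichlet_le_of_near` (`E_V(w)^{1∕2} ≤ E_U(w)^{1∕2} + ε√(d+1)‖w‖`), (the assembly is PART Ϧ-h).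
* (PART Ϧ-h, next file) `‖G(U) − G(V)‖ ≤ 2√(d+1)·s∕(κ√κ) + (2(d+1)s² + 2aDε)∕κ²`, `s = √c·ε = Lε` in King's scaling.
PRIOR TREE ART (by name): Ϳ-g (`star_dotProduct_covLapF_mulVec`), Ϳ-b (`bondE`), Ͱ-b∕Ͱ-f (`fib`, `sum_norm_fib_sq`, `sum_norm_fib_add_unitVec`), Ͱ-q (`l2_opNorm_of_mem_unitaryGroup_le`), Mathlib
(`Finset.sum_mul_sq_le_sq_mul_sq`, `Matrix.l2_opNorm_mulVec`, `Matrix.l2_opNorm_conjTranspose`).  Dedup (rg at filing): basename 0 files; needles `bond_pair_identity|norm_form_covLapF_sub_le|sqrt_dirichlet_le_of_near|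
sqrt_sum_sq_add_le_univ` 0 tree files (the Finset Cauchy–Schwarz `sum_mul_le_sqrt_mul_sqrt` exists in `Literature.Computability.QuantumComplexity.HybridArgument` — caught by the preflight; specialised here).  Locators: [Balaban1985BackgroundPropagators] (3.23)–(3.24) p.394, (3.37) p.396, (3.48)–(3.50)
p.398 (Lipschitz∕holomorphic dependence of the propagators on `U` on the scale `εη` — the SHAPE decided here, one level, King's model); [King1986] (4.4)–(4.5) p.670.  0 `sorry`, 0 `def`.
-/

noncomputable section
open scoped BigOperators ComplexConjugate ComplexOrder InnerProductSpace Matrix.Norms.L2Operator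
open Finset Matrix WithLp

namespace Summit.QuantumFields.YangMills.BalabanUVNodes.N15KingModelRung.CombesThomas

open Literature.MathematicalPhysics.QuantumFieldTheory.LatticeDiamagneticInequality (blk)
open Literature.MathematicalPhysics.QuantumFieldTheory.Balaban1983to89.B5Prop11Plancherel (Tor fine unitVec)
open Literature.MathematicalPhysics.QuantumFieldTheory.King1986.Torus (ctW tdistT_self)
open Summit.QuantumFields.YangMills.BalabanUVNodes.N15KingModelRung.Covariant
  (covLapF fib fib_apply norm_apply_le_norm_fib sum_norm_fib_sq sum_norm_fib_add_unitVec norm_toEuclideanLin_of_mem_unitaryGroup norm_star_dotProduct_le re_star_dotProduct_le_norm_mul_norm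
    l2_opNorm_of_mem_unitaryGroup_le)
open Summit.QuantumFields.YangMills.BalabanUVNodes.N15KingModelRung.Curvature (bondE star_dotProduct_covLapF_mulVec)
open Summit.QuantumFields.YangMills.BalabanUVNodes.N15KingModelRung.CovariantBlock (BlockTree kingComb kingComb_depth_le covQ fullOpU re_quadForm_fullOpU isHermitian_fullOpU)

variable {d : ℕ}
variable {𝕜 : Type*} [RCLike 𝕜] {n : Type*} [Fintype n] [DecidableEq n]

/-! ## §1 One bond: the cancellation `DU^* + UD^* = DD^*` -/

section OneBond

omit [DecidableEq n] in
/-- `⟨a, Wb⟩ = ⟪a, Wb⟫` in `EuclideanSpace 𝕜 n`. [folklore] -/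
theorem star_dotProduct_mulVec_eq_inner' (a b : n → 𝕜) (W : Matrix n n 𝕜) :
    star a ⬝ᵥ (W *ᵥ b) = ⟪(toLp 2 a : EuclideanSpace 𝕜 n), toLp 2 (W *ᵥ b)⟫_𝕜 := by
  rw [EuclideanSpace.inner_toLp_toLp, dotProduct_comm]

/-- CAUCHY–SCHWARZ WITH THE OPERATOR NORM on one fibre: `|⟨a, Wb⟩| ≤ ‖a‖·‖W‖·‖b‖`. [folklore] -/
theorem norm_star_dotProduct_le_fibre (a b : n → 𝕜) (W : Matrix n n 𝕜) :
    ‖star a ⬝ᵥ (W *ᵥ b)‖ ≤ ‖(toLp 2 a : EuclideanSpace 𝕜 n)‖ * (‖W‖ * ‖(toLp 2 b : EuclideanSpace 𝕜 n)‖) := by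
  rw [star_dotProduct_mulVec_eq_inner']
  exact (norm_inner_le_norm _ _).trans (mul_le_mul_of_nonneg_left (Matrix.l2_opNorm_mulVec W (toLp 2 b : EuclideanSpace 𝕜 n)) (norm_nonneg _))

/-- ★★ **THE BOND-PAIR IDENTITY**: for unitary `U, V`, `D = U − V`, and vectors `p, p′, q, q′` of one fibre,
`⟨p, Dq′⟩ + ⟨p′, Dᴴq⟩ = ⟨p, DDᴴq⟩ − ⟨p, DUᴴ(q − Uq′)⟩ − ⟨p − Up′, UDᴴq⟩` — the zeroth-order parts combine to `DUᴴ + UDᴴ = DDᴴ = O(ε²)`, the rest pairs `D` with a COVARIANT DIFFERENCE.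
[cite: Balaban1985BackgroundPropagators, (3.23) p.394, (3.48) p.398 (mechanism)] -/
theorem bond_pair_identity {U V : Matrix n n 𝕜} (hU : U ∈ Matrix.unitaryGroup n 𝕜) (hV : V ∈ Matrix.unitaryGroup n 𝕜) (p p' q q' : n → 𝕜) :
    star p ⬝ᵥ ((U - V) *ᵥ q') + star p' ⬝ᵥ ((U - V)ᴴ *ᵥ q)
      = star p ⬝ᵥ (((U - V) * (U - V)ᴴ) *ᵥ q) - star p ⬝ᵥ (((U - V) * Uᴴ) *ᵥ (q - U *ᵥ q')) - star (p - U *ᵥ p') ⬝ᵥ ((U * (U - V)ᴴ) *ᵥ q) := by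
  have hUU : Uᴴ * U = 1 := by simpa only [star_eq_conjTranspose] using Matrix.mem_unitaryGroup_iff'.mp hU
  have hUU' : U * Uᴴ = 1 := by simpa only [star_eq_conjTranspose] using Matrix.mem_unitaryGroup_iff.mp hU
  have hVV' : V * Vᴴ = 1 := by simpa only [star_eq_conjTranspose] using Matrix.mem_unitaryGroup_iff.mp hV
  set D := U - V with hD
  -- (1) `Dq′ = (DUᴴ)(Uq′)`
  have e1 : D *ᵥ q' = (D * Uᴴ) *ᵥ (U *ᵥ q') := by rw [mulVec_mulVec, Matrix.mul_assoc, hUU, Matrix.mul_one]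
  -- (2) `⟨p′, Dᴴq⟩ = ⟨Up′, (UDᴴ)q⟩`
  have e2 : star p' ⬝ᵥ (Dᴴ *ᵥ q) = star (U *ᵥ p') ⬝ᵥ ((U * Dᴴ) *ᵥ q) := by
    rw [star_mulVec, ← dotProduct_mulVec, mulVec_mulVec, ← Matrix.mul_assoc, hUU, Matrix.one_mul]
  -- (3) `DUᴴ + UDᴴ = DDᴴ`
  have e3 : D * Uᴴ + U * Dᴴ = D * Dᴴ := by
    rw [hD, conjTranspose_sub, sub_mul, mul_sub, mul_sub, sub_mul, sub_mul, hUU', hVV']; abel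
  rw [e1, e2, show U *ᵥ q' = q - (q - U *ᵥ q') by abel, show U *ᵥ p' = p - (p - U *ᵥ p') by abel, Matrix.mulVec_sub, dotProduct_sub, star_sub, sub_dotProduct, ← e3,
    Matrix.add_mulVec, dotProduct_add]
  abel

/-- ★ **THE BOND-PAIR BOUND**: `‖U_b − V_b‖ ≤ ε` ⟹ `|⟨p, Dq′⟩ + ⟨p′, Dᴴq⟩| ≤ ε²‖p‖‖q‖ + ε‖p‖‖q − Uq′‖ + ε‖p − Up′‖‖q‖`. [cite: Balaban1985BackgroundPropagators, (3.48) p.398 (mechanism)] -/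
theorem norm_bond_pair_le {U V : Matrix n n 𝕜} (hU : U ∈ Matrix.unitaryGroup n 𝕜) (hV : V ∈ Matrix.unitaryGroup n 𝕜) {ε : ℝ} (hε : ‖U - V‖ ≤ ε) (p p' q q' : n → 𝕜) :
    ‖star p ⬝ᵥ ((U - V) *ᵥ q') + star p' ⬝ᵥ ((U - V)ᴴ *ᵥ q)‖
      ≤ ε ^ 2 * (‖(toLp 2 p : EuclideanSpace 𝕜 n)‖ * ‖(toLp 2 q : EuclideanSpace 𝕜 n)‖)
        + ε * (‖(toLp 2 p : EuclideanSpace 𝕜 n)‖ * ‖(toLp 2 (q - U *ᵥ q') : EuclideanSpace 𝕜 n)‖)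
        + ε * (‖(toLp 2 (p - U *ᵥ p') : EuclideanSpace 𝕜 n)‖ * ‖(toLp 2 q : EuclideanSpace 𝕜 n)‖) := by
  have hε0 : 0 ≤ ε := (norm_nonneg _).trans hε
  have hU1 : ‖U‖ ≤ 1 := l2_opNorm_of_mem_unitaryGroup_le hU
  have hDD : ‖(U - V) * (U - V)ᴴ‖ ≤ ε ^ 2 := by
    calc ‖(U - V) * (U - V)ᴴ‖ ≤ ‖U - V‖ * ‖(U - V)ᴴ‖ := norm_mul_le _ _
      _ ≤ ε * ε := by rw [Matrix.l2_opNorm_conjTranspose]; exact mul_le_mul hε hε (norm_nonneg _) hε0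
      _ = ε ^ 2 := by ring
  have hDU : ‖(U - V) * Uᴴ‖ ≤ ε := by
    calc ‖(U - V) * Uᴴ‖ ≤ ‖U - V‖ * ‖Uᴴ‖ := norm_mul_le _ _
      _ ≤ ε * 1 := by rw [Matrix.l2_opNorm_conjTranspose]; exact mul_le_mul hε hU1 (norm_nonneg _) hε0
      _ = ε := mul_one ε
  have hUD : ‖U * (U - V)ᴴ‖ ≤ ε := by
    calc ‖U * (U - V)ᴴ‖ ≤ ‖U‖ * ‖(U - V)ᴴ‖ := norm_mul_le _ _
      _ ≤ 1 * ε := by rw [Matrix.l2_opNorm_conjTranspose]; exact mul_le_mul hU1 hε (norm_nonneg _) zero_le_one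
      _ = ε := one_mul ε
  rw [bond_pair_identity hU hV]
  have b1 : ‖star p ⬝ᵥ (((U - V) * (U - V)ᴴ) *ᵥ q)‖ ≤ ε ^ 2 * (‖(toLp 2 p : EuclideanSpace 𝕜 n)‖ * ‖(toLp 2 q : EuclideanSpace 𝕜 n)‖) := by
    refine (norm_star_dotProduct_le_fibre _ _ _).trans ?_
    rw [mul_left_comm]
    exact mul_le_mul_of_nonneg_right hDD (by positivity)
  have b2 : ‖star p ⬝ᵥ (((U - V) * Uᴴ) *ᵥ (q - U *ᵥ q'))‖ ≤ ε * (‖(toLp 2 p : EuclideanSpace 𝕜 n)‖ * ‖(toLp 2 (q - U *ᵥ q') : EuclideanSpace 𝕜 n)‖) := by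
    refine (norm_star_dotProduct_le_fibre _ _ _).trans ?_
    rw [mul_left_comm]
    exact mul_le_mul_of_nonneg_right hDU (by positivity)
  have b3 : ‖star (p - U *ᵥ p') ⬝ᵥ ((U * (U - V)ᴴ) *ᵥ q)‖ ≤ ε * (‖(toLp 2 (p - U *ᵥ p') : EuclideanSpace 𝕜 n)‖ * ‖(toLp 2 q : EuclideanSpace 𝕜 n)‖) := by
    refine (norm_star_dotProduct_le_fibre _ _ _).trans ?_
    rw [mul_left_comm]
    exact mul_le_mul_of_nonneg_right hUD (by positivity)
  exact (norm_sub_le _ _).trans (add_le_add ((norm_sub_le _ _).trans (add_le_add b1 b2)) b3)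

end OneBond

/-! ## §2 The hopping difference is form-bounded by the covariant Dirichlet form -/

section Form

variable (K : Fin (d + 1) → ℕ) [hK : ∀ μ, NeZero (K μ)]

omit hK [RCLike 𝕜] [Fintype n] [DecidableEq n] in
/-- CAUCHY–SCHWARZ for real families over a finite type: `Σ f·g ≤ √(Σf²)·√(Σg²)` (the `Finset` form is `Literature.Computability.QuantumComplexity.sum_mul_le_sqrt_mul_sqrt`, not imported here to
keep the import graph of the rung inside mathematical physics). [folklore] -/
theorem sum_mul_le_sqrt_mul_sqrt_univ {ι : Type*} [Fintype ι] (f g : ι → ℝ) : ∑ i, f i * g i ≤ Real.sqrt (∑ i, f i ^ 2) * Real.sqrt (∑ i, g i ^ 2) := by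
  rw [← Real.sqrt_mul (Finset.sum_nonneg fun i _ => sq_nonneg (f i))]
  exact (le_abs_self _).trans (Real.abs_le_sqrt (Finset.sum_mul_sq_le_sq_mul_sq _ f g))

omit hK [RCLike 𝕜] [Fintype n] [DecidableEq n] in
/-- MINKOWSKI in `ℓ²` over a finite type: `√(Σ(α+β)²) ≤ √(Σα²) + √(Σβ²)`. [folklore] -/
theorem sqrt_sum_sq_add_le_univ {ι : Type*} [Fintype ι] (α β : ι → ℝ) :
    Real.sqrt (∑ i, (α i + β i) ^ 2) ≤ Real.sqrt (∑ i, α i ^ 2) + Real.sqrt (∑ i, β i ^ 2) := by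
  have hA := Real.sqrt_nonneg (∑ i, α i ^ 2)
  have hB := Real.sqrt_nonneg (∑ i, β i ^ 2)
  rw [← Real.sqrt_sq (add_nonneg hA hB)]
  refine Real.sqrt_le_sqrt ?_
  have hcs := sum_mul_le_sqrt_mul_sqrt_univ α β
  calc ∑ i, (α i + β i) ^ 2 = ∑ i, α i ^ 2 + 2 * ∑ i, α i * β i + ∑ i, β i ^ 2 := by
        rw [Finset.mul_sum, ← Finset.sum_add_distrib, ← Finset.sum_add_distrib]; exact Finset.sum_congr rfl fun i _ => by ring
    _ ≤ ∑ i, α i ^ 2 + 2 * (Real.sqrt (∑ i, α i ^ 2) * Real.sqrt (∑ i, β i ^ 2)) + ∑ i, β i ^ 2 := by linarith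
    _ = (Real.sqrt (∑ i, α i ^ 2) + Real.sqrt (∑ i, β i ^ 2)) ^ 2 := by
        rw [add_sq, Real.sq_sqrt (Finset.sum_nonneg fun i _ => sq_nonneg _), Real.sq_sqrt (Finset.sum_nonneg fun i _ => sq_nonneg _)]; ring

/-- ★★★ **THE HOPPING DIFFERENCE IS FORM-BOUNDED BY THE COVARIANT DIRICHLET FORM**: for unitary `U, V` with `‖U_b − V_b‖ ≤ ε` on every bond, `c ≥ 0`, any `m²`, all `w, v`:
`|⟨w, ((−cΔ_U+m²) − (−cΔ_V+m²))v⟩| ≤ c(d+1)ε²‖w‖‖v‖ + cε√(d+1)·(‖w‖·E_U(v)^{1∕2} + E_U(w)^{1∕2}·‖v‖)`, `E_U(v) = Σ_xΣ_μ‖v_x − U(x,μ)v_{x+e_μ}‖²`.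
[cite: Balaban1985BackgroundPropagators, (3.23) p.394, (3.48) p.398 (shape); King1986, (4.4) p.670] -/
theorem norm_form_covLapF_sub_le {c : ℝ} (hc : 0 ≤ c) (m2 : ℝ) {U V : Tor K × Fin (d + 1) → Matrix n n 𝕜} (hU : ∀ b, U b ∈ Matrix.unitaryGroup n 𝕜) (hV : ∀ b, V b ∈ Matrix.unitaryGroup n 𝕜)
    {ε : ℝ} (hε0 : 0 ≤ ε) (hε : ∀ b, ‖U b - V b‖ ≤ ε) (w v : Tor K × n → 𝕜) :
    ‖star w ⬝ᵥ ((covLapF K c m2 U - covLapF K c m2 V) *ᵥ v)‖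
      ≤ c * ((d : ℝ) + 1) * ε ^ 2 * (‖(toLp 2 w : EuclideanSpace 𝕜 (Tor K × n))‖ * ‖(toLp 2 v : EuclideanSpace 𝕜 (Tor K × n))‖)
        + c * ε * Real.sqrt ((d : ℝ) + 1) * (‖(toLp 2 w : EuclideanSpace 𝕜 (Tor K × n))‖ * Real.sqrt (∑ x, ∑ μ, bondE K U v x μ)
            + Real.sqrt (∑ x, ∑ μ, bondE K U w x μ) * ‖(toLp 2 v : EuclideanSpace 𝕜 (Tor K × n))‖) := by
  -- the difference of the two bilinear expansions: diagonals cancel, bonds pair with `D = U − V`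
  have hE : star w ⬝ᵥ ((covLapF K c m2 U - covLapF K c m2 V) *ᵥ v)
      = -((c : 𝕜) * ∑ x, ∑ μ, (star (fun i => w (x, i)) ⬝ᵥ ((U (x, μ) - V (x, μ)) *ᵥ fun j => v (x + unitVec K μ, j))
          + star (fun i => w (x + unitVec K μ, i)) ⬝ᵥ ((U (x, μ) - V (x, μ))ᴴ *ᵥ fun j => v (x, j)))) := by
    rw [Matrix.sub_mulVec, dotProduct_sub, star_dotProduct_covLapF_mulVec, star_dotProduct_covLapF_mulVec]
    simp only [Matrix.sub_mulVec, conjTranspose_sub, dotProduct_sub, Finset.sum_sub_distrib, Finset.sum_add_distrib, mul_sub, mul_add]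
    ring
  rw [hE, norm_neg, norm_mul, RCLike.norm_ofReal, abs_of_nonneg hc]
  -- notation
  set Nw : ℝ := ‖(toLp 2 w : EuclideanSpace 𝕜 (Tor K × n))‖ with hNw
  set Nv : ℝ := ‖(toLp 2 v : EuclideanSpace 𝕜 (Tor K × n))‖ with hNv
  set dv : Tor K → Fin (d + 1) → ℝ := fun x μ => ‖fib K v x - Matrix.toEuclideanLin (U (x, μ)) (fib K v (x + unitVec K μ))‖ with hdv
  set dw : Tor K → Fin (d + 1) → ℝ := fun x μ => ‖fib K w x - Matrix.toEuclideanLin (U (x, μ)) (fib K w (x + unitVec K μ))‖ with hdw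
  have hbv : ∀ x μ, bondE K U v x μ = dv x μ ^ 2 := fun x μ => rfl
  have hbw : ∀ x μ, bondE K U w x μ = dw x μ ^ 2 := fun x μ => rfl
  -- per bond
  have hbond : ∀ x μ, ‖star (fun i => w (x, i)) ⬝ᵥ ((U (x, μ) - V (x, μ)) *ᵥ fun j => v (x + unitVec K μ, j))
        + star (fun i => w (x + unitVec K μ, i)) ⬝ᵥ ((U (x, μ) - V (x, μ))ᴴ *ᵥ fun j => v (x, j))‖
      ≤ ε ^ 2 * (‖fib K w x‖ * ‖fib K v x‖) + ε * (‖fib K w x‖ * dv x μ) + ε * (dw x μ * ‖fib K v x‖) := by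
    intro x μ
    have h := norm_bond_pair_le (hU (x, μ)) (hV (x, μ)) (hε (x, μ)) (fun i => w (x, i)) (fun i => w (x + unitVec K μ, i)) (fun j => v (x, j)) (fun j => v (x + unitVec K μ, j))
    have e1 : (toLp 2 ((fun j => v (x, j)) - U (x, μ) *ᵥ fun j => v (x + unitVec K μ, j)) : EuclideanSpace 𝕜 n)
        = fib K v x - Matrix.toEuclideanLin (U (x, μ)) (fib K v (x + unitVec K μ)) := by
      rw [WithLp.toLp_sub, Matrix.toLpLin_apply]; rfl
    have e2 : (toLp 2 ((fun i => w (x, i)) - U (x, μ) *ᵥ fun i => w (x + unitVec K μ, i)) : EuclideanSpace 𝕜 n)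
        = fib K w x - Matrix.toEuclideanLin (U (x, μ)) (fib K w (x + unitVec K μ)) := by
      rw [WithLp.toLp_sub, Matrix.toLpLin_apply]; rfl
    rw [e1, e2] at h
    exact h
  -- sum the bonds
  have hsum1 : ∑ x, ∑ μ : Fin (d + 1), ‖fib K w x‖ * ‖fib K v x‖ ≤ ((d : ℝ) + 1) * (Nw * Nv) := by
    have h1 : ∑ x, ‖fib K w x‖ * ‖fib K v x‖ ≤ Nw * Nv := by
      have h := sum_mul_le_sqrt_mul_sqrt_univ (fun x => ‖fib K w x‖) (fun x => ‖fib K v x‖)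
      rwa [sum_norm_fib_sq, sum_norm_fib_sq, Real.sqrt_sq (norm_nonneg _), Real.sqrt_sq (norm_nonneg _)] at h
    simp only [Finset.sum_const, Finset.card_univ, Fintype.card_fin, nsmul_eq_mul]
    rw [← Finset.mul_sum]; push_cast; nlinarith
  have hsum2 : ∑ x, ∑ μ : Fin (d + 1), ‖fib K w x‖ * dv x μ ≤ Real.sqrt ((d : ℝ) + 1) * Nw * Real.sqrt (∑ x, ∑ μ, bondE K U v x μ) := by
    have h := sum_mul_le_sqrt_mul_sqrt_univ (fun xm : Tor K × Fin (d + 1) => ‖fib K w xm.1‖) (fun xm => dv xm.1 xm.2)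
    rw [Fintype.sum_prod_type, Fintype.sum_prod_type, Fintype.sum_prod_type] at h
    simp only at h
    have hw2 : ∑ x : Tor K, ∑ _μ : Fin (d + 1), ‖fib K w x‖ ^ 2 = ((d : ℝ) + 1) * Nw ^ 2 := by
      simp only [Finset.sum_const, Finset.card_univ, Fintype.card_fin, nsmul_eq_mul]; rw [← Finset.mul_sum, sum_norm_fib_sq]; push_cast; ring
    rw [hw2, Real.sqrt_mul (by positivity), Real.sqrt_sq (norm_nonneg _)] at h
    simp only [hbv]
    exact h
  have hsum3 : ∑ x, ∑ μ : Fin (d + 1), dw x μ * ‖fib K v x‖ ≤ Real.sqrt (∑ x, ∑ μ, bondE K U w x μ) * (Real.sqrt ((d : ℝ) + 1) * Nv) := by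
    have h := sum_mul_le_sqrt_mul_sqrt_univ (fun xm : Tor K × Fin (d + 1) => dw xm.1 xm.2) (fun xm => ‖fib K v xm.1‖)
    rw [Fintype.sum_prod_type, Fintype.sum_prod_type, Fintype.sum_prod_type] at h
    simp only at h
    have hv2 : ∑ x : Tor K, ∑ _μ : Fin (d + 1), ‖fib K v x‖ ^ 2 = ((d : ℝ) + 1) * Nv ^ 2 := by
      simp only [Finset.sum_const, Finset.card_univ, Fintype.card_fin, nsmul_eq_mul]; rw [← Finset.mul_sum, sum_norm_fib_sq]; push_cast; ring
    rw [hv2, Real.sqrt_mul (by positivity), Real.sqrt_sq (norm_nonneg _)] at h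
    simp only [hbw]
    exact h
  calc c * ‖∑ x, ∑ μ, (star (fun i => w (x, i)) ⬝ᵥ ((U (x, μ) - V (x, μ)) *ᵥ fun j => v (x + unitVec K μ, j))
          + star (fun i => w (x + unitVec K μ, i)) ⬝ᵥ ((U (x, μ) - V (x, μ))ᴴ *ᵥ fun j => v (x, j)))‖
      ≤ c * ∑ x, ∑ μ, (ε ^ 2 * (‖fib K w x‖ * ‖fib K v x‖) + ε * (‖fib K w x‖ * dv x μ) + ε * (dw x μ * ‖fib K v x‖)) := by
        refine mul_le_mul_of_nonneg_left ((norm_sum_le _ _).trans (Finset.sum_le_sum fun x _ => (norm_sum_le _ _).trans (Finset.sum_le_sum fun μ _ => hbond x μ))) hc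
    _ = c * (ε ^ 2 * ∑ x, ∑ μ : Fin (d + 1), ‖fib K w x‖ * ‖fib K v x‖ + ε * ∑ x, ∑ μ : Fin (d + 1), ‖fib K w x‖ * dv x μ + ε * ∑ x, ∑ μ : Fin (d + 1), dw x μ * ‖fib K v x‖) := by
        simp only [Finset.sum_add_distrib, Finset.mul_sum]
    _ ≤ c * (ε ^ 2 * (((d : ℝ) + 1) * (Nw * Nv)) + ε * (Real.sqrt ((d : ℝ) + 1) * Nw * Real.sqrt (∑ x, ∑ μ, bondE K U v x μ))
          + ε * (Real.sqrt (∑ x, ∑ μ, bondE K U w x μ) * (Real.sqrt ((d : ℝ) + 1) * Nv))) := by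
        gcongr
    _ = _ := by ring

/-- ★ **THE DIRICHLET FORMS OF TWO NEARBY FIELDS**: `E_V(w)^{1∕2} ≤ E_U(w)^{1∕2} + ε√(d+1)·‖w‖` (`‖U_b − V_b‖ ≤ ε`; Minkowski, bond by bond `‖w_x − Vw′‖ ≤ ‖w_x − Uw′‖ + ε‖w′‖`).
[cite: Balaban1985BackgroundPropagators, (3.23) p.394] -/
theorem sqrt_dirichlet_le_of_near {U V : Tor K × Fin (d + 1) → Matrix n n 𝕜} {ε : ℝ} (hε0 : 0 ≤ ε) (hε : ∀ b, ‖U b - V b‖ ≤ ε) (w : Tor K × n → 𝕜) :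
    Real.sqrt (∑ x, ∑ μ, bondE K V w x μ) ≤ Real.sqrt (∑ x, ∑ μ, bondE K U w x μ) + ε * Real.sqrt ((d : ℝ) + 1) * ‖(toLp 2 w : EuclideanSpace 𝕜 (Tor K × n))‖ := by
  set α : Tor K × Fin (d + 1) → ℝ := fun xm => ‖fib K w xm.1 - Matrix.toEuclideanLin (U xm) (fib K w (xm.1 + unitVec K xm.2))‖ with hα
  set β : Tor K × Fin (d + 1) → ℝ := fun xm => ε * ‖fib K w (xm.1 + unitVec K xm.2)‖ with hβ
  have hterm : ∀ xm : Tor K × Fin (d + 1), bondE K V w xm.1 xm.2 ≤ (α xm + β xm) ^ 2 := by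
    rintro ⟨x, μ⟩
    have h0 : 0 ≤ α (x, μ) + β (x, μ) := add_nonneg (norm_nonneg _) (by simp only [hβ]; positivity)
    rw [bondE]
    refine pow_le_pow_left₀ (norm_nonneg _) ?_ 2
    have hsplit : fib K w x - Matrix.toEuclideanLin (V (x, μ)) (fib K w (x + unitVec K μ))
        = (fib K w x - Matrix.toEuclideanLin (U (x, μ)) (fib K w (x + unitVec K μ))) + Matrix.toEuclideanLin (U (x, μ) - V (x, μ)) (fib K w (x + unitVec K μ)) := by
      rw [map_sub, LinearMap.sub_apply]; abel
    rw [hsplit]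
    refine (norm_add_le _ _).trans (add_le_add le_rfl ?_)
    calc ‖Matrix.toEuclideanLin (U (x, μ) - V (x, μ)) (fib K w (x + unitVec K μ))‖
        = ‖(toLp 2 ((U (x, μ) - V (x, μ)) *ᵥ ofLp (fib K w (x + unitVec K μ))) : EuclideanSpace 𝕜 n)‖ := by rw [Matrix.toLpLin_apply]
      _ ≤ ‖U (x, μ) - V (x, μ)‖ * ‖fib K w (x + unitVec K μ)‖ := Matrix.l2_opNorm_mulVec _ _
      _ ≤ ε * ‖fib K w (x + unitVec K μ)‖ := mul_le_mul_of_nonneg_right (hε _) (norm_nonneg _)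
  have h1 : ∑ x, ∑ μ, bondE K V w x μ ≤ ∑ xm : Tor K × Fin (d + 1), (α xm + β xm) ^ 2 := by
    rw [Fintype.sum_prod_type]; exact Finset.sum_le_sum fun x _ => Finset.sum_le_sum fun μ _ => hterm (x, μ)
  have h2 : ∑ xm : Tor K × Fin (d + 1), α xm ^ 2 = ∑ x, ∑ μ, bondE K U w x μ := by rw [Fintype.sum_prod_type]; rfl
  have h3 : ∑ xm : Tor K × Fin (d + 1), β xm ^ 2 = (ε * Real.sqrt ((d : ℝ) + 1) * ‖(toLp 2 w : EuclideanSpace 𝕜 (Tor K × n))‖) ^ 2 := by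
    rw [Fintype.sum_prod_type]
    simp only [hβ, mul_pow]
    rw [Real.sq_sqrt (by positivity), ← sum_norm_fib_sq]
    simp only [← Finset.mul_sum]
    rw [Finset.sum_comm]
    simp only [sum_norm_fib_add_unitVec, Finset.sum_const, Finset.card_univ, Fintype.card_fin, nsmul_eq_mul]
    push_cast; ring
  calc Real.sqrt (∑ x, ∑ μ, bondE K V w x μ) ≤ Real.sqrt (∑ xm : Tor K × Fin (d + 1), (α xm + β xm) ^ 2) := Real.sqrt_le_sqrt h1
    _ ≤ Real.sqrt (∑ xm : Tor K × Fin (d + 1), α xm ^ 2) + Real.sqrt (∑ xm : Tor K × Fin (d + 1), β xm ^ 2) := sqrt_sum_sq_add_le_univ α β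
    _ = _ := by rw [h2, h3, Real.sqrt_sq (by positivity)]

end Form

end Summit.QuantumFields.YangMills.BalabanUVNodes.N15KingModelRung.CombesThomas

end
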